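import Mathlib
import Literature.Probability.LatticeModels.ProdBernoulliIndependence
import Literature.Probability.Percolation.SharpnessDCTProofs
import Literature.Probability.Percolation.PercolationProofs
import HarnessLib

/-!
# Crux `PercNearOneGluing.NearOneGluing` (stmt-CriticalPhenomena-4574), line
# `live-seal-vanishing-sprinkle` — stub `stub_exposureDecomp` (exposure decomposition)

Helper file for the crux (lead prover-line-stmt-CriticalPhenomena-4574-a1-0, wave 1): proves exactly
the registered stub `stub_exposureDecomp` of the line skeleton — K1 ("buffered bad pockets are
cheap") modulo the transfer integrals, which enter as the hypothesis `hT`. Lands with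
`--supports stmt-CriticalPhenomena-4574`.

Setting: bond configurations `ω : Set (Sym2 (Fin n))` under `μ = prodBernoulli w`; a relay set `A`,
a source `o ∉ A`, a target `b`; an abstract *pocket selector* `P` with
`v ∈ P ω ↔ ω ∈ openConnIn (↑A)ᶜ o v` (the relay-free pocket of `o`) and an abstract *live-pair
selector* `L` with `e ∈ L T ω ↔ ∃ x ∈ T, ∃ y ∉ T, e = s(x, y) ∧ ω ∈ openConnIn (↑T)ᶜ y b`;
`κ_T(ω) = ∏_{e ∈ L T ω} (1 - w e)`.

## Statement (`stub_exposureDecomp`)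

If `∫ 1{∀ e ∈ E, e ↮ b inside (↑T)ᶜ} κ_T dμ ≤ c` for all admissible `(T, E, a)` (`a ∈ E ⊆ A`,
`o ∈ T ∌ b`, `T ∩ A = ∅`), then `μ{o ↮ b ∧ o ↔ A ∧ θ ≤ κ_{P ω}(ω)} ≤ c / θ` (`θ > 0`, `c ≥ 0`).

## Proof (strong Markov property at the pocket, finitary form)

Partition by the value `(T, E)` of `(P ω, E*(ω))`, `E*(ω) = {a ∈ A | ∃ x ∈ P ω, s(x, a) ∈ ω}` the
relays *attached* to the pocket. A nonempty piece is admissible — `E ≠ ∅` because the first exit of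
an open `o–a` path from the pocket goes to a relay (`exposureDecomp_exists_attached`) — and lies in
`{P = T, E* = E} ∩ {∀ e ∈ E, e ↮ b off T} ∩ {θ ≤ κ_T}` (an attached relay joined to `b` would join
`o` to `b`, `exposureDecomp_mem_openConn_of_attached`). The class `{P = T, E* = E}` is determined by
the pairs incident to `T` (`exposureDecomp_determinedBy_class`: on it every vertex of `T` is joined
to `o` inside `T` and the first exit of an open relay-free path from `T` is impossible), the cut
event and `L T ·` by the pairs inside `(↑T)ᶜ` (`DCT16.determinedBy_openConnIn`); the two pair sets
are disjoint, so the measure factorises (`prodBernoulli_real_inter_of_determinedBy`). Markov's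
inequality `θ μ(D ∩ {θ ≤ κ}) ≤ ∫ 1_D κ` (`exposureDecomp_markov`) and `hT` bound the second factor
by `c / θ`, and `Σ_{(T,E)} μ(P = T, E* = E) = 1` (`sum_measureReal_preimage_singleton`).
-/

namespace Summit.CriticalPhenomena.PercolationContinuityZ3.Theorems

open scoped BigOperators Classical
open MeasureTheory Set
open Literature.Probability.LatticeModels (prodBernoulli)
open Literature.Probability.Percolation

section ExposureDecompWalks

variable {n : ℕ} {A : Finset (Fin n)} {o b : Fin n} {P : Set (Sym2 (Fin n)) → Finset (Fin n)}

/-- The source lies in its own relay-free pocket (when it is not a relay). -/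
theorem exposureDecomp_self_mem_pocket
    (hP : ∀ ω v, v ∈ P ω ↔ ω ∈ openConnIn ((↑A : Set (Fin n))ᶜ) o v) (ho : o ∉ A)
    (ω : Set (Sym2 (Fin n))) : o ∈ P ω := by
  have hoU : o ∈ (↑A : Set (Fin n))ᶜ := fun h => ho (Finset.mem_coe.1 h)
  exact (hP ω o).2 ⟨hoU, hoU, SimpleGraph.Reachable.refl _⟩

/-- The relay-free pocket contains no relay. -/
theorem exposureDecomp_pocket_disjoint
    (hP : ∀ ω v, v ∈ P ω ↔ ω ∈ openConnIn ((↑A : Set (Fin n))ᶜ) o v)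
    (ω : Set (Sym2 (Fin n))) : Disjoint (P ω) A := by
  refine Finset.disjoint_left.2 fun v hv hvA => ?_
  obtain ⟨-, hv', -⟩ := (hP ω v).1 hv
  exact hv' (Finset.mem_coe.2 hvA)

/-- The pocket is closed under open pairs towards non-relays. -/
theorem exposureDecomp_pocket_step
    (hP : ∀ ω v, v ∈ P ω ↔ ω ∈ openConnIn ((↑A : Set (Fin n))ᶜ) o v)
    {ω : Set (Sym2 (Fin n))} {x y : Fin n} (hx : x ∈ P ω) (he : s(x, y) ∈ ω) (hyA : y ∉ A) :
    y ∈ P ω := by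
  by_cases hxy : x = y
  · exact hxy ▸ hx
  · have hp : PathIn (openGraph ω) ((↑A : Set (Fin n))ᶜ) o x :=
      DCT16.pathIn_of_mem_openConnIn ((hP ω x).1 hx)
    exact (hP ω y).2 (DCT16.mem_openConnIn_of_pathIn
      (hp.tail ((openGraph_adj ω x y).2 ⟨he, hxy⟩) (fun h => hyA (Finset.mem_coe.1 h))))

/-- A vertex not joined to `o` is not in the pocket. -/
theorem exposureDecomp_notMem_pocket_of_notMem_openConn
    (hP : ∀ ω v, v ∈ P ω ↔ ω ∈ openConnIn ((↑A : Set (Fin n))ᶜ) o v)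
    {ω : Set (Sym2 (Fin n))} {v : Fin n} (hv : ω ∉ openConn o v) : v ∉ P ω := fun h =>
  hv (DCT16.reachable_of_pathIn (DCT16.pathIn_of_mem_openConnIn ((hP ω v).1 h)))

/-- **First exit.** On `{o ↔ a}` with `a ∈ A`, some relay is attached to the pocket by an open
pair: the first exit of an open `o–a` path from the pocket goes to a relay (a non-relay outer
endpoint would lie in the pocket). -/
theorem exposureDecomp_exists_attached
    (hP : ∀ ω v, v ∈ P ω ↔ ω ∈ openConnIn ((↑A : Set (Fin n))ᶜ) o v) (ho : o ∉ A)
    {ω : Set (Sym2 (Fin n))} {a : Fin n} (haA : a ∈ A) (hoa : ω ∈ openConn o a) :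
    ∃ y ∈ A, ∃ x ∈ P ω, s(x, y) ∈ ω := by
  have hoP : o ∈ P ω := exposureDecomp_self_mem_pocket hP ho ω
  have haP : a ∉ P ω := fun h => Finset.disjoint_left.1 (exposureDecomp_pocket_disjoint hP ω) h haA
  obtain ⟨x, y, hx, hy, -, hxy, -⟩ := (DCT16.pathIn_univ_of_reachable hoa).exit
    (R := (↑(P ω) : Set (Fin n))) (Finset.mem_coe.2 hoP) (fun h => haP (Finset.mem_coe.1 h))
  rw [openGraph_adj] at hxy
  have hx' : x ∈ P ω := Finset.mem_coe.1 hx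
  have hyA : y ∈ A := by
    by_contra hyA
    exact hy (Finset.mem_coe.2 (exposureDecomp_pocket_step hP hx' hxy.1 hyA))
  exact ⟨y, hyA, x, hx', hxy.1⟩

/-- An attached relay joined to `b` (inside any vertex set) joins `o` to `b`. -/
theorem exposureDecomp_mem_openConn_of_attached
    (hP : ∀ ω v, v ∈ P ω ↔ ω ∈ openConnIn ((↑A : Set (Fin n))ᶜ) o v)
    {ω : Set (Sym2 (Fin n))} {x y : Fin n} (hx : x ∈ P ω) (he : s(x, y) ∈ ω) (hyA : y ∈ A)
    {U : Set (Fin n)} (hyb : ω ∈ openConnIn U y b) : ω ∈ openConn o b := by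
  have h1 : (openGraph ω).Reachable o x :=
    DCT16.reachable_of_pathIn (DCT16.pathIn_of_mem_openConnIn ((hP ω x).1 hx))
  have hne : x ≠ y := fun h =>
    Finset.disjoint_left.1 (exposureDecomp_pocket_disjoint hP ω) hx (h ▸ hyA)
  have h2 : (openGraph ω).Adj x y := (openGraph_adj ω x y).2 ⟨he, hne⟩
  have h3 : (openGraph ω).Reachable y b :=
    DCT16.reachable_of_pathIn (DCT16.pathIn_of_mem_openConnIn hyb)
  exact h1.trans (h2.reachable.trans h3)

/-- On `{P = T}`, every vertex of `T` is joined to `o` by an open path inside `T`. -/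
theorem exposureDecomp_pathIn_of_pocket_eq
    (hP : ∀ ω v, v ∈ P ω ↔ ω ∈ openConnIn ((↑A : Set (Fin n))ᶜ) o v) (ho : o ∉ A)
    {ω : Set (Sym2 (Fin n))} {T : Finset (Fin n)} (hT : P ω = T) {v : Fin n} (hv : v ∈ T) :
    PathIn (openGraph ω) (↑T : Set (Fin n)) o v := by
  subst hT
  have hp : PathIn (openGraph ω) ((↑A : Set (Fin n))ᶜ) o v :=
    DCT16.pathIn_of_mem_openConnIn ((hP ω v).1 hv)
  rcases hp.exit_or (R := (↑(P ω) : Set (Fin n)))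
      (Finset.mem_coe.2 (exposureDecomp_self_mem_pocket hP ho ω)) with h | ⟨x, y, hx, hy, hyA, hxy, -⟩
  · exact h.mono Set.inter_subset_left
  · exfalso
    rw [openGraph_adj] at hxy
    exact hy (Finset.mem_coe.2 (exposureDecomp_pocket_step hP (Finset.mem_coe.1 hx) hxy.1
      (fun h => hyA (Finset.mem_coe.2 h))))

/-- **Locality of the pocket.** If `ω, ω'` agree on a pair set `F` containing every pair incident
to `T`, and `P ω = T`, then `P ω' = T`. -/
theorem exposureDecomp_pocket_eq_of_inter_eq
    (hP : ∀ ω v, v ∈ P ω ↔ ω ∈ openConnIn ((↑A : Set (Fin n))ᶜ) o v) (ho : o ∉ A)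
    {F : Finset (Sym2 (Fin n))} {T : Finset (Fin n)} (hF : ∀ x y, x ∈ T → s(x, y) ∈ F)
    {ω ω' : Set (Sym2 (Fin n))} (h : ω ∩ ↑F = ω' ∩ ↑F) (hT : P ω = T) : P ω' = T := by
  have hoT : o ∈ T := hT ▸ exposureDecomp_self_mem_pocket hP ho ω
  have hTA : Disjoint T A := hT ▸ exposureDecomp_pocket_disjoint hP ω
  have hK : (↑T : Set (Fin n)).sym2 ⊆ (↑F : Set (Sym2 (Fin n))) := by
    intro e he
    revert he
    induction e using Sym2.ind with
    | _ x y =>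
      intro he
      exact Finset.mem_coe.2 (hF x y (Finset.mem_coe.1 (Set.mk_mem_sym2_iff.1 he).1))
  ext v
  constructor
  · intro hv
    by_contra hvT
    have hp : PathIn (openGraph ω') ((↑A : Set (Fin n))ᶜ) o v :=
      DCT16.pathIn_of_mem_openConnIn ((hP ω' v).1 hv)
    obtain ⟨x, y, hx, hy, hyA, hxy, -⟩ := hp.exit (R := (↑T : Set (Fin n)))
      (Finset.mem_coe.2 hoT) (fun h' => hvT (Finset.mem_coe.1 h'))
    rw [openGraph_adj] at hxy
    have heF : s(x, y) ∈ (↑F : Set (Sym2 (Fin n))) := Finset.mem_coe.2 (hF x y (Finset.mem_coe.1 hx))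
    have heω : s(x, y) ∈ ω := (((Set.ext_iff.1 h) _).2 ⟨hxy.1, heF⟩).1
    have hxP : x ∈ P ω := by rw [hT]; exact Finset.mem_coe.1 hx
    have hyP : y ∈ P ω :=
      exposureDecomp_pocket_step hP hxP heω (fun h' => hyA (Finset.mem_coe.2 h'))
    rw [hT] at hyP
    exact hy (Finset.mem_coe.2 hyP)
  · intro hvT
    have hp : PathIn (openGraph ω) (↑T : Set (Fin n)) o v :=
      exposureDecomp_pathIn_of_pocket_eq hP ho hT hvT
    have hp' : PathIn (openGraph ω') (↑T : Set (Fin n)) o v := DCT16.pathIn_congr_of_inter_eq hK h hp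
    refine (hP ω' v).2 (DCT16.mem_openConnIn_of_pathIn (hp'.mono fun u hu huA => ?_))
    exact Finset.disjoint_left.1 hTA (Finset.mem_coe.1 hu) (Finset.mem_coe.1 huA)

/-- **The class `{P = T, E* = E}` is determined by the pairs incident to `T`** (`E*(ω)` = the
relays attached to the pocket by an open pair). -/
theorem exposureDecomp_determinedBy_class
    (hP : ∀ ω v, v ∈ P ω ↔ ω ∈ openConnIn ((↑A : Set (Fin n))ᶜ) o v) (ho : o ∉ A)
    {F : Finset (Sym2 (Fin n))} (T E : Finset (Fin n)) (hF : ∀ x y, x ∈ T → s(x, y) ∈ F) :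
    DeterminedBy {ω | P ω = T ∧ (A.filter fun a => ∃ x ∈ P ω, s(x, a) ∈ ω) = E}
      (↑F : Set (Sym2 (Fin n))) := by
  rw [determinedBy_iff]
  suffices key : ∀ ω ω' : Set (Sym2 (Fin n)), ω ∩ ↑F = ω' ∩ ↑F →
      ω ∈ {ω | P ω = T ∧ (A.filter fun a => ∃ x ∈ P ω, s(x, a) ∈ ω) = E} →
      ω' ∈ {ω | P ω = T ∧ (A.filter fun a => ∃ x ∈ P ω, s(x, a) ∈ ω) = E} from
    fun ω ω' h => ⟨key ω ω' h, key ω' ω h.symm⟩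
  rintro ω ω' h ⟨hT, hE⟩
  have hT' : P ω' = T := exposureDecomp_pocket_eq_of_inter_eq hP ho hF h hT
  refine ⟨hT', ?_⟩
  rw [← hE, hT, hT']
  refine Finset.filter_congr fun a _ => exists_congr fun x => and_congr_right fun hx => ?_
  have heF : s(x, a) ∈ (↑F : Set (Sym2 (Fin n))) := Finset.mem_coe.2 (hF x a hx)
  exact ⟨fun h1 => (((Set.ext_iff.1 h) _).2 ⟨h1, heF⟩).1,
    fun h1 => (((Set.ext_iff.1 h) _).1 ⟨h1, heF⟩).1⟩

variable {L : Finset (Fin n) → Set (Sym2 (Fin n)) → Finset (Sym2 (Fin n))}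

/-- **Locality of the live pairs.** Configurations agreeing on a pair set containing the pairs
inside `(↑T)ᶜ` have the same live pairs `L T ·`. -/
theorem exposureDecomp_live_eq_of_inter_eq
    (hL : ∀ T ω e, e ∈ L T ω ↔
      ∃ x ∈ T, ∃ y ∉ T, e = s(x, y) ∧ ω ∈ openConnIn ((↑T : Set (Fin n))ᶜ) y b)
    {T : Finset (Fin n)} {K : Set (Sym2 (Fin n))} (hK : ((↑T : Set (Fin n))ᶜ).sym2 ⊆ K)
    {ω ω' : Set (Sym2 (Fin n))} (h : ω ∩ K = ω' ∩ K) : L T ω = L T ω' := by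
  ext e
  rw [hL T ω e, hL T ω' e]
  refine exists_congr fun x => and_congr_right fun _ => exists_congr fun y =>
    and_congr_right fun _ => and_congr_right fun _ => ?_
  exact (determinedBy_iff _ _).1 (DCT16.determinedBy_openConnIn _ y b hK) ω ω' h

/-- The cut event `{∀ e ∈ E, e ↮ b inside (↑T)ᶜ}` is determined by any pair set containing the
pairs inside `(↑T)ᶜ`. -/
theorem exposureDecomp_determinedBy_cut (T E : Finset (Fin n)) (b : Fin n)
    {K : Set (Sym2 (Fin n))} (hK : ((↑T : Set (Fin n))ᶜ).sym2 ⊆ K) :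
    DeterminedBy {ω : Set (Sym2 (Fin n)) | ∀ e ∈ E, ω ∉ openConnIn ((↑T : Set (Fin n))ᶜ) e b} K := by
  rw [determinedBy_iff]
  intro ω ω' h
  simp only [mem_setOf_eq]
  refine forall₂_congr fun e _ => not_congr ?_
  exact (determinedBy_iff _ _).1 (DCT16.determinedBy_openConnIn _ e b hK) ω ω' h

/-- Any event read off the live pairs `L T ω` is determined by any pair set containing the pairs
inside `(↑T)ᶜ`. -/
theorem exposureDecomp_determinedBy_live
    (hL : ∀ T ω e, e ∈ L T ω ↔
      ∃ x ∈ T, ∃ y ∉ T, e = s(x, y) ∧ ω ∈ openConnIn ((↑T : Set (Fin n))ᶜ) y b)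
    (T : Finset (Fin n)) (Q : Finset (Sym2 (Fin n)) → Prop)
    {K : Set (Sym2 (Fin n))} (hK : ((↑T : Set (Fin n))ᶜ).sym2 ⊆ K) :
    DeterminedBy {ω : Set (Sym2 (Fin n)) | Q (L T ω)} K := by
  rw [determinedBy_iff]
  intro ω ω' h
  simp only [mem_setOf_eq]
  rw [exposureDecomp_live_eq_of_inter_eq hL hK h]

/-- The pairs inside `(↑T)ᶜ` avoid the set of pairs incident to `T`. -/
theorem exposureDecomp_sym2_compl_subset (T : Finset (Fin n)) :
    ((↑T : Set (Fin n))ᶜ).sym2 ⊆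
      (↑(Finset.univ.filter fun e : Sym2 (Fin n) => ∃ x ∈ T, ∃ y, e = s(x, y)) :
        Set (Sym2 (Fin n)))ᶜ := by
  intro e he heF
  rw [Finset.coe_filter] at heF
  obtain ⟨-, x, hx, y, rfl⟩ := heF
  exact (Set.mk_mem_sym2_iff.1 he).1 (Finset.mem_coe.2 hx)

/-- Every pair incident to `T` lies in the set of pairs incident to `T`. -/
theorem exposureDecomp_mem_incident {T : Finset (Fin n)} (x y : Fin n) (hx : x ∈ T) :
    s(x, y) ∈ (Finset.univ.filter fun e : Sym2 (Fin n) => ∃ x ∈ T, ∃ y, e = s(x, y)) :=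
  Finset.mem_filter.2 ⟨Finset.mem_univ _, x, hx, y, rfl⟩

end ExposureDecompWalks


section ExposureDecompMain

variable {n : ℕ}

/-- **Markov step.** For a nonnegative function `κ`, an event `D` and `θ > 0`:
`θ · μ(D ∩ {θ ≤ κ}) ≤ ∫ 1_D κ dμ` on the finite configuration space. -/
theorem exposureDecomp_markov (w : Sym2 (Fin n) → unitInterval) (D : Set (Set (Sym2 (Fin n))))
    (κ : Set (Sym2 (Fin n)) → ℝ) (hκ : ∀ ω, 0 ≤ κ ω) (θ : ℝ) :
    θ * (prodBernoulli w).real (D ∩ {ω | θ ≤ κ ω}) ≤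
      ∫ ω, D.indicator κ ω ∂(prodBernoulli w) := by
  rw [mul_comm, ← smul_eq_mul, ← integral_indicator_const θ MeasurableSet.of_discrete]
  refine integral_mono Integrable.of_finite Integrable.of_finite fun ω => ?_
  by_cases hω : ω ∈ D ∩ {ω | θ ≤ κ ω}
  · rw [indicator_of_mem hω, indicator_of_mem hω.1]
    exact hω.2
  · rw [indicator_of_notMem hω]
    exact Set.indicator_nonneg (fun ω _ => hκ ω) ω

/-- **Stub 2 of the line `live-seal-vanishing-sprinkle` (exposure decomposition = K1 modulo the
transfer integrals).** With the relay-free pocket `P ω` (`v ∈ P ω ↔ o ↔ v inside (↑A)ᶜ`) and the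
live pairs `L T ω` (`s(x, y)`, `x ∈ T`, `y ∉ T`, `y ↔ b inside (↑T)ᶜ`): if every transfer integral
`∫ 1{∀ e ∈ E, e ↮ b inside (↑T)ᶜ} · ∏_{e ∈ L T ω} (1 - w e) dμ` over admissible `(T, E, a)`
(`o ∈ T`, `b ∉ T`, `T ∩ A = ∅`, `a ∈ E ⊆ A`) is `≤ c`, then
`μ{o ↮ b ∧ o ↔ A ∧ θ ≤ ∏_{e ∈ L (P ω) ω} (1 - w e)} ≤ c / θ`.
Proof: partition by the value `(T, E)` of `(P ω, E*(ω))`, `E*(ω)` = the relays attached to the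
pocket by an open pair. A nonempty piece is admissible (`E ≠ ∅` by the first-exit lemma
`exposureDecomp_exists_attached`) and lies in `{P = T, E* = E} ∩ {cut_E} ∩ {θ ≤ κ_T}` (an attached
relay joined to `b` off `T` would join `o` to `b`); the class is determined by the pairs incident to
`T`, the other two events by the pairs inside `(↑T)ᶜ`, so the measure factorises
(`prodBernoulli_real_inter_of_determinedBy`); Markov's inequality and the hypothesis bound the second
factor by `c / θ`; finally `Σ_{(T,E)} μ(P = T, E* = E) = 1`. -/
theorem stub_exposureDecomp (n : ℕ) (w : Sym2 (Fin n) → unitInterval) (A : Finset (Fin n))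
    (o b : Fin n) (ho : o ∉ A) (c θ : ℝ) (hc : 0 ≤ c) (hθ : 0 < θ)
    (P : Set (Sym2 (Fin n)) → Finset (Fin n))
    (hP : ∀ ω v, v ∈ P ω ↔ ω ∈ openConnIn ((↑A : Set (Fin n))ᶜ) o v)
    (L : Finset (Fin n) → Set (Sym2 (Fin n)) → Finset (Sym2 (Fin n)))
    (hL : ∀ T ω e, e ∈ L T ω ↔
      ∃ x ∈ T, ∃ y ∉ T, e = s(x, y) ∧ ω ∈ openConnIn ((↑T : Set (Fin n))ᶜ) y b)
    (hT : ∀ (T E : Finset (Fin n)) (a : Fin n), a ∈ E → E ⊆ A → o ∈ T → b ∉ T → Disjoint T A →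
      ∫ ω, ({ω | ∀ e ∈ E, ω ∉ openConnIn ((↑T : Set (Fin n))ᶜ) e b}.indicator
          (fun ω => ∏ e ∈ L T ω, (1 - (w e : ℝ))) ω) ∂(prodBernoulli w) ≤ c) :
    (prodBernoulli w).real {ω | ω ∉ openConn o b ∧ (∃ a ∈ A, ω ∈ openConn o a) ∧
        θ ≤ ∏ e ∈ L (P ω) ω, (1 - (w e : ℝ))} ≤ c / θ := by
  set μ := prodBernoulli w with hμ
  -- the attached relays `E*(ω)` and the class map `ω ↦ (P ω, E*(ω))`
  set cls : Set (Sym2 (Fin n)) → Finset (Fin n) × Finset (Fin n) :=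
    fun ω => (P ω, A.filter fun a => ∃ x ∈ P ω, s(x, a) ∈ ω) with hcls
  set S : Set (Set (Sym2 (Fin n))) := {ω | ω ∉ openConn o b ∧ (∃ a ∈ A, ω ∈ openConn o a) ∧
    θ ≤ ∏ e ∈ L (P ω) ω, (1 - (w e : ℝ))} with hS
  have hcθ : 0 ≤ c / θ := div_nonneg hc hθ.le
  -- the per-class bound
  have hclass : ∀ p : Finset (Fin n) × Finset (Fin n),
      μ.real (S ∩ cls ⁻¹' {p}) ≤ μ.real (cls ⁻¹' {p}) * (c / θ) := by
    rintro ⟨T, E⟩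
    by_cases hem : S ∩ cls ⁻¹' {(T, E)} = ∅
    · rw [hem, measureReal_empty]
      exact mul_nonneg measureReal_nonneg hcθ
    obtain ⟨ω₀, hω₀S, hω₀c⟩ := Set.nonempty_iff_ne_empty.2 hem
    rw [mem_preimage, mem_singleton_iff, hcls, Prod.mk.injEq] at hω₀c
    obtain ⟨hPT, hET⟩ := hω₀c
    obtain ⟨hω₀b, ⟨a₀, ha₀A, hω₀a⟩, -⟩ := hω₀S
    -- admissibility of the class, read off `ω₀`
    have hoT : o ∈ T := hPT ▸ exposureDecomp_self_mem_pocket hP ho ω₀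
    have hTA : Disjoint T A := hPT ▸ exposureDecomp_pocket_disjoint hP ω₀
    have hbT : b ∉ T := hPT ▸ exposureDecomp_notMem_pocket_of_notMem_openConn hP hω₀b
    have hEA : E ⊆ A := hET ▸ Finset.filter_subset _ _
    obtain ⟨a, haE⟩ : E.Nonempty := by
      obtain ⟨y, hyA, x, hxP, hxy⟩ := exposureDecomp_exists_attached hP ho ha₀A hω₀a
      exact ⟨y, hET ▸ Finset.mem_filter.2 ⟨hyA, x, hxP, hxy⟩⟩
    -- the pairs incident to `T` and the three events
    set F : Finset (Sym2 (Fin n)) := Finset.univ.filter fun e : Sym2 (Fin n) =>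
      ∃ x ∈ T, ∃ y, e = s(x, y) with hF
    have hFT : ∀ x y, x ∈ T → s(x, y) ∈ F := fun x y hx => exposureDecomp_mem_incident x y hx
    have hK : ((↑T : Set (Fin n))ᶜ).sym2 ⊆ (↑F : Set (Sym2 (Fin n)))ᶜ :=
      exposureDecomp_sym2_compl_subset T
    set D : Set (Set (Sym2 (Fin n))) :=
      {ω | ∀ e ∈ E, ω ∉ openConnIn ((↑T : Set (Fin n))ᶜ) e b} with hD
    set B : Set (Set (Sym2 (Fin n))) := {ω | θ ≤ ∏ e ∈ L T ω, (1 - (w e : ℝ))} with hB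
    have hsub : S ∩ cls ⁻¹' {(T, E)} ⊆ cls ⁻¹' {(T, E)} ∩ (D ∩ B) := by
      rintro ω ⟨⟨hωb, -, hωθ⟩, hωc⟩
      have hωc' := hωc
      rw [mem_preimage, mem_singleton_iff, hcls, Prod.mk.injEq] at hωc'
      obtain ⟨hPω, hEω⟩ := hωc'
      refine ⟨hωc, fun e he heb => hωb ?_, ?_⟩
      · rw [← hEω, Finset.mem_filter] at he
        obtain ⟨heA, x, hx, hxe⟩ := he
        exact exposureDecomp_mem_openConn_of_attached hP hx hxe heA heb
      · show θ ≤ ∏ e ∈ L T ω, (1 - (w e : ℝ))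
        rw [← hPω]; exact hωθ
    have hdetC : DeterminedBy (cls ⁻¹' {(T, E)}) (↑F : Set (Sym2 (Fin n))) := by
      have hpre : cls ⁻¹' {(T, E)} =
          {ω | P ω = T ∧ (A.filter fun a => ∃ x ∈ P ω, s(x, a) ∈ ω) = E} := by
        ext ω
        simp only [mem_preimage, mem_singleton_iff, hcls, Prod.mk.injEq, mem_setOf_eq]
      rw [hpre]
      exact exposureDecomp_determinedBy_class hP ho T E hFT
    have hdetDB : DeterminedBy (D ∩ B) (↑F : Set (Sym2 (Fin n)))ᶜ :=
      (exposureDecomp_determinedBy_cut T E b hK).inter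
        (exposureDecomp_determinedBy_live hL T (fun M => θ ≤ ∏ e ∈ M, (1 - (w e : ℝ))) hK)
    have hind : μ.real (cls ⁻¹' {(T, E)} ∩ (D ∩ B)) =
        μ.real (cls ⁻¹' {(T, E)}) * μ.real (D ∩ B) :=
      Literature.Probability.LatticeModels.prodBernoulli_real_inter_of_determinedBy w F hdetC
        hdetDB MeasurableSet.of_discrete MeasurableSet.of_discrete
    -- Markov and the transfer hypothesis
    have hmarkov : μ.real (D ∩ B) ≤ c / θ := by
      rw [le_div_iff₀ hθ, mul_comm]
      exact (exposureDecomp_markov w D (fun ω => ∏ e ∈ L T ω, (1 - (w e : ℝ)))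
        (fun ω => Finset.prod_nonneg fun e _ => sub_nonneg.2 (w e).2.2) θ).trans
        (hT T E a haE hEA hoT hbT hTA)
    calc μ.real (S ∩ cls ⁻¹' {(T, E)})
        ≤ μ.real (cls ⁻¹' {(T, E)} ∩ (D ∩ B)) := measureReal_mono hsub
      _ = μ.real (cls ⁻¹' {(T, E)}) * μ.real (D ∩ B) := hind
      _ ≤ μ.real (cls ⁻¹' {(T, E)}) * (c / θ) :=
          mul_le_mul_of_nonneg_left hmarkov measureReal_nonneg
  -- assembly: partition by the class
  have hcover : S ⊆ ⋃ p ∈ (Finset.univ : Finset (Finset (Fin n) × Finset (Fin n))),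
      (S ∩ cls ⁻¹' {p}) := by
    intro ω hω
    simp only [mem_iUnion, exists_prop]
    exact ⟨cls ω, Finset.mem_univ _, hω, rfl⟩
  have hsum : ∑ p ∈ (Finset.univ : Finset (Finset (Fin n) × Finset (Fin n))),
      μ.real (cls ⁻¹' {p}) = 1 := by
    rw [sum_measureReal_preimage_singleton _ (fun _ _ => MeasurableSet.of_discrete),
      Finset.coe_univ, Set.preimage_univ, probReal_univ]
  calc μ.real S
      ≤ μ.real (⋃ p ∈ (Finset.univ : Finset (Finset (Fin n) × Finset (Fin n))),
          (S ∩ cls ⁻¹' {p})) := measureReal_mono hcover (measure_ne_top _ _)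
    _ ≤ ∑ p ∈ (Finset.univ : Finset (Finset (Fin n) × Finset (Fin n))),
          μ.real (S ∩ cls ⁻¹' {p}) := measureReal_biUnion_finset_le _ _
    _ ≤ ∑ p ∈ (Finset.univ : Finset (Finset (Fin n) × Finset (Fin n))),
          μ.real (cls ⁻¹' {p}) * (c / θ) := Finset.sum_le_sum fun p _ => hclass p
    _ = c / θ := by rw [← Finset.sum_mul, hsum, one_mul]

end ExposureDecompMain

end Summit.CriticalPhenomena.PercolationContinuityZ3.Theorems
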